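import Mathlib
import HarnessLib
import Literature.Analysis.FluidPDE.ClassicalSolution
import Literature.Analysis.FluidPDE.LerayHopf
import Literature.Analysis.FluidPDE.LerayHopfProofs
import Literature.Analysis.FluidPDE.DyadicChaining

/-!
# Shelf 1574, LINE 9 «trace_transfer»: STUB 3 — TRACE TRANSFER under the edge law (pure measure theory)

Helper file (`--supports stmt-NavierStokesRegularity-1574 --as helper`) for the banked line
`Cruxes/EnstrophyQuarterLaw/Lines/trace_transfer.lean` (ns-idea-9 g4, LINE 9; idea-crit-8 V35
PASS-WITH-PRICE «corollary grade»; KEY-NS #131 (1) / #136 (1): typed cross-route edge 1574 ⇒ 18384/18385).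
The main statement is the line's registered `stub_traceTransfer` with its Cruxes-local predicates
`EdgeBound`, `FastL3Bound`, `LocalSliceL3Bound` UNFOLDED VERBATIM (size M): the edge bound
`‖u(s) − u(T)‖₂² ≤ D√(T−s)` on `[t₀, T)`, the fast bound `∫_{|u(s)|>(T−s)^{-1/2}} |u(s)|³ ≤ C` on `[0, T)` and
ONE terminal slice `u(T) ∈ L³(B(x₀, ρ))` force bounded `L³(B(x₀, ρ))` slices on `(t₀, T)`.

THE LEVER, POINTWISE. Write `λ = (√(T−s))⁻¹`, `w = u(s) − u(T)`, `m = |u(T)|`. On the SLOW SET `|u(s)| ≤ λ`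
one has `|w| ≤ λ + m`, hence `|w|³ ≤ λ|w|² + m|w|² ≤ λ|w|² + (2|w|³ + m³)/3` (AM–GM,
`2a³ + m³ − 3a²m = (a − m)²(2a + m) ≥ 0`), i.e. `|w|³ ≤ 3λ|w|² + m³`, and `|u(s)|³ ≤ (|w| + m)³ ≤ 4|w|³ + 4m³`
(the tree's `DyadicChaining.add_pow_three_le_four`),
so
  `|u(s)|³ ≤ 12 λ |u(s) − u(T)|² + 8 |u(T)|³`   on `{|u(s)| ≤ λ}`   (`norm_cube_le_of_slow`).
Integrating over `B(x₀, ρ) ∩ {|u(s)| ≤ λ}` and using `λ · D√(T−s) = D`: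
  `∫_{B} |u(s)|³ ≤ C + 12 D + 8 ∫_{B} |u(T)|³`   (`setLIntegral_ball_cube_le_of_edge_of_fast`),
a bound uniform in `s` — the integrability of the single terminal slice TRANSFERS to every late slice below the
self-similar threshold, the fast part being paid by `C`. This pointwise form replaces the Hölder absorption
`X³ ≤ D + ‖u(T)‖_{L³(B)}X²` of the line card (same content, no a-priori finiteness needed). Nothing NS-specific
is used beyond measurability of the slices (classical below `T`, Leray–Hopf at `T`).

No summit statement is proved: `EnstrophyQuarterLaw` (1574), `TraceScarL3` (18384), `TypeITraceScarL3`
(18385) stay OPEN; nothing here proves NS regularity.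
-/

noncomputable section

-- the summit-side namespace repeats a component by design (D-0017)
set_option linter.dupNamespace false

namespace Summit.NavierStokesRegularity.NavierStokesRegularity.Theorems.EnstrophyQuarterLaw.TraceTransfer

open Set MeasureTheory Function Metric Filter Topology
open scoped ENNReal NNReal
open Literature.Analysis.FluidPDE

/-! ### The pointwise lever on the slow set -/

/-- **AM–GM in the form used**: `3 m a² ≤ 2 a³ + m³` for `a, m ≥ 0`
(`2a³ + m³ − 3a²m = (a − m)²(2a + m)`). [folklore] -/
theorem three_mul_mul_sq_le {a m : ℝ} (ha : 0 ≤ a) (hm : 0 ≤ m) :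
    3 * m * a ^ 2 ≤ 2 * a ^ 3 + m ^ 3 := by
  nlinarith [mul_nonneg (sq_nonneg (a - m)) (by positivity : (0 : ℝ) ≤ 2 * a + m)]

/-- **The slow-set inequality (real form).** In a normed group, if `‖v‖ ≤ λ` then
`‖v‖³ ≤ 12 λ ‖v − z‖² + 8 ‖z‖³`: with `a = ‖v − z‖`, `m = ‖z‖`, `a ≤ λ + m` gives
`a³ ≤ λa² + m a² ≤ λ a² + (2a³ + m³)/3`, so `a³ ≤ 3λa² + m³`, and `‖v‖³ ≤ (a + m)³ ≤ 4a³ + 4m³`. [folklore] -/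
theorem norm_cube_le_of_slow {F : Type*} [NormedAddCommGroup F] (v z : F) {lam : ℝ}
    (hv : ‖v‖ ≤ lam) : ‖v‖ ^ 3 ≤ 12 * lam * ‖v - z‖ ^ 2 + 8 * ‖z‖ ^ 3 := by
  set a : ℝ := ‖v - z‖ with ha_def
  set m : ℝ := ‖z‖ with hm_def
  have ha : 0 ≤ a := norm_nonneg _
  have hm : 0 ≤ m := norm_nonneg _
  have h1 : ‖v‖ ≤ a + m := by
    calc ‖v‖ = ‖(v - z) + z‖ := by rw [sub_add_cancel]
      _ ≤ ‖v - z‖ + ‖z‖ := norm_add_le _ _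
  have h2 : a ≤ lam + m := (norm_sub_le v z).trans (add_le_add hv le_rfl)
  have h3 : a ^ 3 ≤ (lam + m) * a ^ 2 := by
    rw [pow_succ' a 2]
    exact mul_le_mul_of_nonneg_right h2 (sq_nonneg a)
  have h4 := three_mul_mul_sq_le ha hm
  have h3' : a ^ 3 ≤ lam * a ^ 2 + m * a ^ 2 := by linarith [add_mul lam m (a ^ 2)]
  have h5 : a ^ 3 ≤ 3 * lam * a ^ 2 + m ^ 3 := by linarith
  have h6 : ‖v‖ ^ 3 ≤ (a + m) ^ 3 := pow_le_pow_left₀ (norm_nonneg _) h1 3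
  have h7 := Literature.Analysis.FluidPDE.DyadicChaining.add_pow_three_le_four ha hm
  linarith

/-- **The slow-set inequality (extended form)**: if `‖v‖ ≤ λ` then
`‖v‖ₑ³ ≤ ofReal (12λ) ‖v − z‖ₑ² + 8 ‖z‖ₑ³`. [folklore] -/
theorem enorm_cube_le_of_slow {F : Type*} [NormedAddCommGroup F] (v z : F) {lam : ℝ}
    (hv : ‖v‖ ≤ lam) :
    ‖v‖ₑ ^ 3 ≤ ENNReal.ofReal (12 * lam) * ‖v - z‖ₑ ^ 2 + 8 * ‖z‖ₑ ^ 3 := by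
  have h := norm_cube_le_of_slow v z hv
  have hlam : 0 ≤ lam := (norm_nonneg v).trans hv
  have e8 : (8 : ℝ≥0∞) = ENNReal.ofReal 8 := by norm_num
  rw [← ofReal_norm, ← ofReal_norm, ← ofReal_norm, ← ENNReal.ofReal_pow (norm_nonneg _),
    ← ENNReal.ofReal_pow (norm_nonneg _), ← ENNReal.ofReal_pow (norm_nonneg _), e8,
    ← ENNReal.ofReal_mul (by positivity), ← ENNReal.ofReal_mul (by norm_num),
    ← ENNReal.ofReal_add (by positivity) (by positivity)]
  exact ENNReal.ofReal_le_ofReal h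

/-! ### One slice: the transfer -/

/-- **Trace transfer, one slice.** Let `v, z : ℝ³ → ℝ³` with `v` continuous and `z` a.e. strongly measurable
(the slices `u(s)`, `u(T)`), `λ > 0` with `λ · e = 1` (`λ = (√(T−s))⁻¹`, `e = √(T−s)`), the edge bound
`∫ |v − z|² ≤ D e` and the fast bound `∫_{|v| > λ} |v|³ ≤ C`. Then for every ball `B`,
`∫_B |v|³ ≤ C + 12 D + 8 ∫_B |z|³` (split `B` at the level `λ`; on the slow part integrate
`enorm_cube_le_of_slow`). [folklore] -/
theorem setLIntegral_ball_cube_le_of_edge_of_fast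
    {v z : EuclideanSpace ℝ (Fin 3) → EuclideanSpace ℝ (Fin 3)} (hv : Continuous v)
    (hz : AEStronglyMeasurable z volume) {lam e D C : ℝ} (hlam : 0 < lam) (hle : lam * e = 1)
    (hedge : ∫⁻ x, ‖v x - z x‖ₑ ^ 2 ≤ ENNReal.ofReal (D * e))
    (hfast : ∫⁻ x in {x | lam < ‖v x‖}, ‖v x‖ₑ ^ 3 ≤ ENNReal.ofReal C)
    (x₀ : EuclideanSpace ℝ (Fin 3)) (ρ : ℝ) :
    ∫⁻ x in ball x₀ ρ, ‖v x‖ₑ ^ 3 ≤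
      ENNReal.ofReal C + ENNReal.ofReal (12 * D) + 8 * ∫⁻ x in ball x₀ ρ, ‖z x‖ₑ ^ 3 := by
  set Fst : Set (EuclideanSpace ℝ (Fin 3)) := {x | lam < ‖v x‖} with hFst
  have hF : MeasurableSet Fst := (isOpen_lt continuous_const hv.norm).measurableSet
  -- split the ball at the level `λ`
  rw [← lintegral_inter_add_sdiff _ (ball x₀ ρ) hF]
  -- the fast part
  have h1 : ∫⁻ x in ball x₀ ρ ∩ Fst, ‖v x‖ₑ ^ 3 ≤ ENNReal.ofReal C :=
    (lintegral_mono_set inter_subset_right).trans hfast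
  -- the slow part, pointwise
  have hslow : ∀ x ∈ ball x₀ ρ \ Fst,
      ‖v x‖ₑ ^ 3 ≤ ENNReal.ofReal (12 * lam) * ‖v x - z x‖ₑ ^ 2 + 8 * ‖z x‖ₑ ^ 3 := by
    intro x hx
    have hxs : ‖v x‖ ≤ lam := not_lt.1 hx.2
    exact enorm_cube_le_of_slow (v x) (z x) hxs
  have hmeas : AEMeasurable (fun x => ENNReal.ofReal (12 * lam) * ‖v x - z x‖ₑ ^ 2)
      (volume.restrict (ball x₀ ρ \ Fst)) :=
    (((hv.aestronglyMeasurable.sub hz).aemeasurable.enorm.pow_const 2).const_mul _).restrict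
  have h2 : ∫⁻ x in ball x₀ ρ \ Fst, ‖v x‖ₑ ^ 3 ≤
      ENNReal.ofReal (12 * D) + 8 * ∫⁻ x in ball x₀ ρ, ‖z x‖ₑ ^ 3 := by
    calc ∫⁻ x in ball x₀ ρ \ Fst, ‖v x‖ₑ ^ 3
        ≤ ∫⁻ x in ball x₀ ρ \ Fst,
            (ENNReal.ofReal (12 * lam) * ‖v x - z x‖ₑ ^ 2 + 8 * ‖z x‖ₑ ^ 3) :=
          setLIntegral_mono' (measurableSet_ball.diff hF) hslow
      _ = (∫⁻ x in ball x₀ ρ \ Fst, ENNReal.ofReal (12 * lam) * ‖v x - z x‖ₑ ^ 2) +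
            ∫⁻ x in ball x₀ ρ \ Fst, 8 * ‖z x‖ₑ ^ 3 := lintegral_add_left' hmeas _
      _ = ENNReal.ofReal (12 * lam) * (∫⁻ x in ball x₀ ρ \ Fst, ‖v x - z x‖ₑ ^ 2) +
            8 * ∫⁻ x in ball x₀ ρ \ Fst, ‖z x‖ₑ ^ 3 := by
          rw [lintegral_const_mul' _ _ ENNReal.ofReal_ne_top, lintegral_const_mul' _ _ (by norm_num)]
      _ ≤ ENNReal.ofReal (12 * lam) * (∫⁻ x, ‖v x - z x‖ₑ ^ 2) +
            8 * ∫⁻ x in ball x₀ ρ, ‖z x‖ₑ ^ 3 :=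
          add_le_add (mul_le_mul' le_rfl (setLIntegral_le_lintegral _ _))
            (mul_le_mul' le_rfl (lintegral_mono_set fun x hx => hx.1))
      _ ≤ ENNReal.ofReal (12 * lam) * ENNReal.ofReal (D * e) +
            8 * ∫⁻ x in ball x₀ ρ, ‖z x‖ₑ ^ 3 :=
          add_le_add (mul_le_mul' le_rfl hedge) le_rfl
      _ = ENNReal.ofReal (12 * D) + 8 * ∫⁻ x in ball x₀ ρ, ‖z x‖ₑ ^ 3 := by
          rw [← ENNReal.ofReal_mul (by positivity)]
          congr 2
          calc 12 * lam * (D * e) = 12 * D * (lam * e) := by ring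
            _ = 12 * D := by rw [hle, mul_one]
  calc (∫⁻ x in ball x₀ ρ ∩ Fst, ‖v x‖ₑ ^ 3) + ∫⁻ x in ball x₀ ρ \ Fst, ‖v x‖ₑ ^ 3
      ≤ ENNReal.ofReal C + (ENNReal.ofReal (12 * D) + 8 * ∫⁻ x in ball x₀ ρ, ‖z x‖ₑ ^ 3) :=
        add_le_add h1 h2
    _ = ENNReal.ofReal C + ENNReal.ofReal (12 * D) + 8 * ∫⁻ x in ball x₀ ρ, ‖z x‖ₑ ^ 3 :=
        (add_assoc _ _ _).symm

/-! ### The registered stub -/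

/-- **STUB 3 of LINE 9 «trace_transfer», registered signature with `EdgeBound` / `FastL3Bound` /
`LocalSliceL3Bound` unfolded verbatim — TRACE TRANSFER.** For `ν > 0`, `T > 0`, `(u, p)` classical on
`[0, T) × ℝ³` and Leray–Hopf on `[0, T]` from `u 0`: if `‖u(s) − u(T)‖₂² ≤ D√(T−s)` for `s ∈ [t₀, T)`
(`0 ≤ t₀ < T`), `∫_{|u(s)| > (√(T−s))⁻¹} |u(s)|³ ≤ C` for `s ∈ [0, T)`, and `u(T) ∈ L³(B(x₀, ρ))` (`ρ > 0`), then
`∫_{B(x₀,ρ)} |u(s)|³ ≤ C'` for all `s ∈ (t₀, T)` with `C' = max C 0 + 12 max D 0 + 8 ∫_{B(x₀,ρ)} |u(T)|³`.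
[folklore] -/
theorem stub_traceTransfer :
    ∀ (ν T : ℝ), 0 < ν → 0 < T →
      ∀ (u : ℝ → EuclideanSpace ℝ (Fin 3) → EuclideanSpace ℝ (Fin 3)) (p : ℝ → EuclideanSpace ℝ (Fin 3) → ℝ),
        IsClassicalNSSolutionOn (Set.Ico 0 T) ν 0 u p → IsLerayHopfOn T ν 0 (u 0) u →
        ∀ (D t₀ C : ℝ), 0 ≤ t₀ → t₀ < T →
        (∀ s ∈ Set.Ico t₀ T, ∫⁻ x, ‖u s x - u T x‖ₑ ^ 2 ≤ ENNReal.ofReal (D * Real.sqrt (T - s))) →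
        (∀ s ∈ Set.Ico 0 T,
          ∫⁻ x in {x | (Real.sqrt (T - s))⁻¹ < ‖u s x‖}, ‖u s x‖ₑ ^ 3 ≤ ENNReal.ofReal C) →
        ∀ (x₀ : EuclideanSpace ℝ (Fin 3)) (ρ : ℝ), 0 < ρ →
          MemLp (u T) 3 (volume.restrict (ball x₀ ρ)) →
          ∃ C t₀ : ℝ, t₀ < T ∧ ∀ s ∈ Set.Ioo t₀ T, ∫⁻ x in ball x₀ ρ, ‖u s x‖ₑ ^ 3 ≤ ENNReal.ofReal C := by
  intro ν T _hν hT u p hcl hLH D t₀ C ht₀ ht₀T hedge hfast x₀ ρ _hρ hL3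
  -- the terminal slice: measurable, with `N = ∫_B |u(T)|³ < ∞`
  have huT : AEStronglyMeasurable (u T) volume := (hLH.memLp T ⟨hT.le, le_rfl⟩).1
  set N : ℝ≥0∞ := ∫⁻ x in ball x₀ ρ, ‖u T x‖ₑ ^ 3 with hN
  have hNtop : N ≠ ⊤ := by
    have h := eLpNorm_natCast_pow_eq_lintegral (volume.restrict (ball x₀ ρ)) (u T) (n := 3) (by norm_num)
    simp only [Nat.cast_ofNat] at h
    rw [hN, ← h]
    exact ENNReal.pow_ne_top hL3.eLpNorm_ne_top
  refine ⟨max C 0 + 12 * max D 0 + 8 * N.toReal, t₀, ht₀T, fun s hs => ?_⟩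
  have hsI : s ∈ Ico t₀ T := ⟨hs.1.le, hs.2⟩
  have hs0 : s ∈ Ico 0 T := ⟨ht₀.trans hs.1.le, hs.2⟩
  have hτ : 0 < T - s := sub_pos.2 hs.2
  set e : ℝ := Real.sqrt (T - s) with he
  have hepos : 0 < e := Real.sqrt_pos.2 hτ
  have hlam : 0 < e⁻¹ := inv_pos.2 hepos
  have hle : e⁻¹ * e = 1 := inv_mul_cancel₀ hepos.ne'
  have hv : Continuous (u s) := (hcl.contDiff_velocity hs0).continuous
  have h := setLIntegral_ball_cube_le_of_edge_of_fast hv huT hlam hle (hedge s hsI) (hfast s hs0) x₀ ρ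
  refine h.trans ?_
  -- `ofReal C + ofReal (12 D) + 8 N ≤ ofReal (max C 0 + 12 max D 0 + 8 N.toReal)`
  have e8 : (8 : ℝ≥0∞) * N = ENNReal.ofReal (8 * N.toReal) := by
    rw [ENNReal.ofReal_mul (by norm_num), ENNReal.ofReal_toReal hNtop]
    norm_num
  rw [e8, ENNReal.ofReal_add (by positivity) (by positivity),
    ENNReal.ofReal_add (le_max_right _ _) (by positivity)]
  gcongr
  · exact le_max_left _ _
  · exact le_max_left _ _

end Summit.NavierStokesRegularity.NavierStokesRegularity.Theorems.EnstrophyQuarterLaw.TraceTransfer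

end
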